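import Summits.QuantumFields.YangMills.Theorems.BalabanUVNodesN11TopChildStepWeight
import Literature.MathematicalPhysics.QuantumFieldTheory.Balaban1983to89.Node00.TkFirstStepRegionVanishing
import Literature.MathematicalPhysics.QuantumFieldTheory.Balaban1983to89.Node00.TkNoExpansionStepSucc
import Literature.MathematicalPhysics.QuantumFieldTheory.Balaban1983to89.Node00.Sect2FormOfRecord

/-!
# DAG node N11 — 11a's `𝐓_{k+1}(s)` AND def-T's SLOTS AT THE TOP CHILD `(Ω_{k+1}, Λ_{k+1}) = (𝕋, 𝕋)`: NO integration is left in `𝐓` (every generation has EMPTY bond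
# sets), `𝐓_{k+1}(s_top)[W] Φ (V) = (Π_{j ≤ k} ζ_j(∅)·w_j(𝕋, ∅, ∅))(base_{k+1} V) · Φ(∅-branch, 0, base V)`; hence the §2-form slot there is
# `prefactor(V′) · exp A_{k+1}(s_top; t, E)(U_{k+1}(V′))` and def-T's pre-𝐑 slot is `(Π_{□′} χ_{□′}(V′)) · ∫dU δ(ŪV′⁻¹) [χ′_k(ALL)(U,V′) · Σ_S ζ_{k+1}(∅,∅,(∅,S))(U,V′) · χ_k ρ_k(U)]`
# — the (O3′) identity at the top child is [I] Thm 1's small-field step as ONE explicit identity in the new field, with NO conditional expectation per fibre left to read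

HEADER — WORK-UNIT METADATA.  Cell `pub-ymgap`, YM-PLAN Track A (HUMAN RULING D-0062), seat `pub-ymgap-dag-n11-d` (g18; N11 [B14], s2), route `BalabanUVNodes`, item K1⁹ =
stmt-QuantumFields-27364 (helper lane, `--kind proof --supports 27364 --as helper`, count-neutral).  [III] = [Balaban1988Convergent], [I] = [Balaban1987RG1].  Over
def-T's 11a `Node00.TkOfRecord` (`genOp`, `tkBranchOfRecord`, `TkOfRecord`, `TkOfRecord_of_eq`, `vOp_kernelRT_of_isEmpty`, `aOp_of_isEmpty`), 11c `Node00.Sect2FormOfRecord`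
(`sect2Slot = TkOfRecord ∘ sect2Operand`), FILE 1∕2 (`transportOfRecord`, `slotsTOfRecord_succ_apply` in this seat's g3 `TkNoExpansionStepSucc`), g6's `measurable_avgRestrOfRecord`,
and this seat's g18 `…N11TopChildStepWeight` (the step weight of record at the top child in closed form).

WHY THIS FILE.  The -d lane's (O3′) road (g10–g17) ends, per 𝐓-present child `s′` and old branch, in ONE one-fibre conditional-expectation identity with 11a's intrinsic reading
`R̃` on the right (`…N11O3OfFibreCondExpAtRecord13`, p658744).  At the TOP CHILD `(Ω_{k+1}, Λ_{k+1})(s′) = (𝕋, 𝕋)` — [IV] (0.2)'s small-field term, the MAIN term of (2.18) —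
that machinery is not needed at all: by (2.1) the whole history is all-small, so EVERY generation `𝐓^{(j)}(s′, S)` of 11a has EMPTY V-, V′- and A-bond sets
(`B_j(Ω^c_{j+1}) = B_j(∅)`, `B_j(Λ^c_{j+1} ∩ Ω_{j+1}) = B_j(∅)`), the `{S_j}`-index is the all-empty branch alone, and `𝐓_{k+1}(s′)` is MULTIPLICATION by the scalar
`Π_{j ≤ k} ζ_j(∅)·χ(∅,∅)·e^{−½ quad_j(𝕋)}` read at the base configuration ((2.22): «no variables ⇒ no integral»).  So the §2-form slot `sect2Slot` at the top child is that scalar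
times `exp A_{k+1}(s′; t, E)` at the background of record, and the (O3′) identity there reads: def-T's ONE-STEP TRANSPORT of the weighted old slot EQUALS an explicit function of
`V′` — [I] Thm 1 + [II] ([III] Thm 2 at the top child) with every letter of def-T's open.  This file proves those unfoldings; the successor states the Stage-13 (O3′) editions.

WHAT THIS FILE PROVES (0 `def`, 0 `sorry`, standard axioms; generic fluctuation space `V`, weights `W`, run, couplings, level).
§1 11a AT AN ALL-SMALL GENERATION ∕ HISTORY: `isEmpty_sV_of_Omega_univ` ∕ `isEmpty_sV'_of_Omega_univ` ∕ `isEmpty_sA_of_Lambda_univ` · ★ `genOp_genDataOfRecord_of_top` (the generation is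
   multiplication by `ζ_j · w_j`) · `Seq_allSmall_of_top` ((2.1): a history with top pair `(𝕋, 𝕋)` is all-small) · ★★ `tkBranchOfRecord_of_allSmall` (the branch operator is
   multiplication by `Π_{j<i} ζ_j(∅)·w_j(𝕋,∅,S_{j+1})`, POINTWISE) · ★★ `TkOfRecord_of_allSmall` ∕ `TkOfRecord_succ_of_top` (`𝐓_k(s)[W]Φ(V) = prefactor(base_k V) · Φ(∅, 0, base V)`).
§2 THE §2-FORM SLOT AT THE TOP CHILD: ★★ `sect2Slot_top_eq` (`sect2Slot … s_top t E U V′ = prefactor(V′) · exp A_{k+1}(s_top; t, (∅, 0), E)(U(base_{k+1} V′))`).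
§3 def-T's PRE-𝐑 SLOT AT THE TOP CHILD with n02-b's weights of record: `transportOfRecord_const_mul` · ★★ `slotsTOfRecord_succ_top_eq` (the front product `Π_{□′} χ_{□′}(V′)` PULLED
   OUT of the transport; inside: `χ′_k(ALL cubes)(U,V′) · Σ_S ζ_{k+1}(∅,∅,(∅,S))(U,V′) · χ_k(init)(U) · slot_k(init)(U)`) · ★★ `slotsTOfRecord_succ_top_eq_of_chiSeq_ne_zero` (on the
   `χ_{k+1}`-support the front product is `1`) · ★★★ `O3_top_iff` — at the top child the (O3′)-shaped clause «`slotT = 0 ∨ ∀ᵐ V′, χ_{k+1} V′ ≠ 0 → slotT V′ = sect2Slot V′`» IS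
   «`slotT = 0 ∨ ∀ᵐ V′, χ_{k+1} V′ ≠ 0 → ∫dU δ(ŪV′⁻¹)[χ′_k(ALL)·Σ_S ζ·χ_k·slot_k](V′) = prefactor(V′) · exp A_{k+1}(…)(V′)`» — ONE explicit identity in `V′`, no fibre, no chart.

HONEST FRAMING.  Kernel bookkeeping over def-T's ∕ n02-b's definitions (count-neutral); the identity is DISPLAYED as an equivalence of shapes, NOT proved — it IS [I] Thm 1
(+ [II]) at the main term; nothing of Bałaban asserted; the prefactor `Π_j ζ_j(∅)·w_j(𝕋,∅,∅)` at the base configuration is the witness's residual datum (print: `1`), displayed,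
not evaluated.  N11 NOT discharged; K1⁹ NOT closed; no registered stub touched; counts unmoved (typed 28∕28 · discharged 5∕27 · A 5∕28).  One finite `𝕋⁴_{L^K}` programme at fixed
`ε = L^{−K}` — NOT ℝ⁴, NOT OS, NOT a mass gap, NOT Clay.  No `sorry`, `axiom`, `def`, `instance`, `notation`.  Sources (SHAPE only): [III] (2.1) p.254, (2.18) p.257,
(2.20)–(2.22) p.258, (2.23) p.258, (3.1) p.264, (3.2)–(3.5) p.265, (3.23)–(3.25) p.270, Thm 1 p.262, Thm 2 p.263; [I] Thm 1 p.259, (0.4) p.253; [IV] = [Balaban1989LargeFieldI] (0.2) p.176.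
-/

noncomputable section

open MeasureTheory
open scoped BigOperators Matrix.Norms.L2Operator

namespace Summit.QuantumFields.YangMills.Theorems.BalabanUVNodesN11TopChildTStep

open Literature.MathematicalPhysics.QuantumFieldTheory.Balaban1983to89 T4Continuum Node00 Node00.Tk B14.Eq218Concrete B14.Sect3Decomp
open B10Eq42TorusConstraint (bondsIn mem_bondsIn_iff)
open T4AveragingDisintegration (kernelTransport)
open BalabanUVNodesN11TopChildStepWeight (wOfRecord_top_eq_prod prod_chiFactor_eq_one_of_chiSeq_top_ne_zero)

variable {F : T4Family} {N : ℕ} [NeZero N]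

/-! ## §1. 11a at an all-small generation ∕ history: no bond variables, `𝐓` is multiplication by its scalar weights -/

section Generation

variable (V : Type) (ν : Stage7Numerics) (M : ℕ) (g : ℕ → ℝ) (K : ℕ) (W : TkWeights F N V K)

/-- **NO V-BONDS AT AN ALL-SMALL GENERATION**: at `Ω_{j+1}(s) = 𝕋` the level-`j` V-bond set `B_j(Ω^c_{j+1})` of 11a's generation data is EMPTY. [cite: Balaban1988Convergent, (2.21)–(2.22) p.258] -/
theorem isEmpty_sV_of_Omega_univ {k : ℕ} (s : SeqOfRecord F ν M g K k) (S : ℕ → Set (Site (F.P K) 0)) (j : ℕ) {hdec : DecidableEq (PBond (F.P K) j)}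
    (hΩ : s.Ω (j + 1) = Set.univ) : IsEmpty ↥(genDataOfRecord F N V ν M g K W s S j).sV := by
  refine ⟨fun b => ?_⟩
  have hb : (b : PBond (F.P K) j) ∈ (Set.toFinite (bondsIn j (s.Ω (j + 1))ᶜ)).toFinset := b.2
  rw [Set.Finite.mem_toFinset, mem_bondsIn_iff, hΩ, Set.compl_univ] at hb
  exact hb.1

/-- … and so is its image bond set `B_{j+1}(Ω^c_{j+1})`. [cite: Balaban1988Convergent, (2.21)–(2.22) p.258] -/
theorem isEmpty_sV'_of_Omega_univ {k : ℕ} (s : SeqOfRecord F ν M g K k) (S : ℕ → Set (Site (F.P K) 0)) (j : ℕ) {hdec : DecidableEq (PBond (F.P K) j)}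
    (hΩ : s.Ω (j + 1) = Set.univ) : IsEmpty ↥(genDataOfRecord F N V ν M g K W s S j).sV' := by
  refine ⟨fun b => ?_⟩
  have hb : (b : PBond (F.P K) (j + 1)) ∈ (Set.toFinite (bondsIn (j + 1) (s.Ω (j + 1))ᶜ)).toFinset := b.2
  rw [Set.Finite.mem_toFinset, mem_bondsIn_iff, hΩ, Set.compl_univ] at hb
  exact hb.1

/-- **NO A-BONDS AT AN ALL-SMALL GENERATION**: at `Λ_{j+1}(s) = 𝕋` the A-bond set `B_j(Λ^c_{j+1} ∩ Ω_{j+1})` is EMPTY ((2.22): no fluctuation integral).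
[cite: Balaban1988Convergent, (2.22) p.258, (3.23) p.270] -/
theorem isEmpty_sA_of_Lambda_univ {k : ℕ} (s : SeqOfRecord F ν M g K k) (S : ℕ → Set (Site (F.P K) 0)) (j : ℕ) {hdec : DecidableEq (PBond (F.P K) j)}
    (hΛ : s.Λ (j + 1) = Set.univ) : IsEmpty ↥(genDataOfRecord F N V ν M g K W s S j).sA := by
  refine ⟨fun b => ?_⟩
  have hb : (b : PBond (F.P K) j) ∈ (Set.toFinite (bondsIn j ((s.Λ (j + 1))ᶜ ∩ s.Ω (j + 1)))).toFinset := b.2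
  rw [Set.Finite.mem_toFinset, mem_bondsIn_iff, hΛ, Set.compl_univ, Set.empty_inter] at hb
  exact hb.1

variable [NormedAddCommGroup V] [InnerProductSpace ℝ V] [FiniteDimensional ℝ V] [MeasurableSpace V] [BorelSpace V]

/-- ★ **AN ALL-SMALL GENERATION OF 11a IS MULTIPLICATION BY ITS TWO WEIGHTS**: at `Ω_{j+1}(s) = Λ_{j+1}(s) = 𝕋`,
`𝐓^{(j)}(s, S) Φ (ω) = ζ_j(Ω^c_{j+1})(ω) · (w_j(Λ_{j+1}, Λ^c_{j+1} ∩ Ω_{j+1}, S_{j+1})(ω) · Φ(ω))` — the V-factor over empty bond sets is the identity (`vOp_kernelRT_of_isEmpty`), the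
A-factor over the empty A-bond set is multiplication by its weight (`aOp_of_isEmpty`); (2.22). [cite: Balaban1988Convergent, (2.21)–(2.22) p.258] -/
theorem genOp_genDataOfRecord_of_top {k : ℕ} (s : SeqOfRecord F ν M g K k) (S : ℕ → Set (Site (F.P K) 0)) (j : ℕ) {hdec : DecidableEq (PBond (F.P K) j)}
    (hΩ : s.Ω (j + 1) = Set.univ) (hΛ : s.Λ (j + 1) = Set.univ) (Φ : MultiCfg (F.P K) (SU N) V → ℝ) (ω : MultiCfg (F.P K) (SU N) V) :
    genOp j (genDataOfRecord F N V ν M g K W s S j) Φ ω =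
      W.ζ j (s.Ω (j + 1))ᶜ ω * (W.w j (s.Λ (j + 1)) ((s.Λ (j + 1))ᶜ ∩ s.Ω (j + 1)) (S (j + 1)) ω * Φ ω) := by
  haveI := isEmpty_sV_of_Omega_univ V ν M g K W s S j (hdec := hdec) hΩ
  haveI := isEmpty_sV'_of_Omega_univ V ν M g K W s S j (hdec := hdec) hΩ
  haveI := isEmpty_sA_of_Lambda_univ V ν M g K W s S j (hdec := hdec) hΛ
  rw [genOp_apply]
  change vOp j (genDataOfRecord F N V ν M g K W s S j).sV (genDataOfRecord F N V ν M g K W s S j).sV'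
      (kernelRT (avgRestrOfRecord F N K j (genDataOfRecord F N V ν M g K W s S j).sV (genDataOfRecord F N V ν M g K W s S j).sV')) _ ω = _
  rw [vOp_kernelRT_of_isEmpty _ _ _ _ (measurable_avgRestrOfRecord (F := F) (N := N) K j _ _), zetaOp_apply, aOp_of_isEmpty]
  rfl

/-- The same with the regions simplified: `𝐓^{(j)}(s, S) Φ (ω) = ζ_j(∅)(ω) · (w_j(𝕋, ∅, S_{j+1})(ω) · Φ(ω))`. [cite: Balaban1988Convergent, (2.22) p.258] -/
theorem genOp_genDataOfRecord_of_top' {k : ℕ} (s : SeqOfRecord F ν M g K k) (S : ℕ → Set (Site (F.P K) 0)) (j : ℕ) {hdec : DecidableEq (PBond (F.P K) j)}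
    (hΩ : s.Ω (j + 1) = Set.univ) (hΛ : s.Λ (j + 1) = Set.univ) (Φ : MultiCfg (F.P K) (SU N) V → ℝ) (ω : MultiCfg (F.P K) (SU N) V) :
    genOp j (genDataOfRecord F N V ν M g K W s S j) Φ ω = W.ζ j ∅ ω * (W.w j Set.univ ∅ (S (j + 1)) ω * Φ ω) := by
  rw [genOp_genDataOfRecord_of_top V ν M g K W s S j (hdec := hdec) hΩ hΛ Φ ω, hΩ, hΛ, Set.compl_univ, Set.empty_inter]

omit [NeZero N] in
/-- **(2.1): A HISTORY WITH TOP PAIR `(Ω_{k+1}, Λ_{k+1}) = (𝕋, 𝕋)` IS ALL-SMALL**: `Ω_j = Λ_j = 𝕋` for `1 ≤ j ≤ k+1` (`Λ_{k+1} ⊆ Λ_j ⊆ Ω_j`).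
[cite: Balaban1988Convergent, (2.1) p.254; Balaban1989LargeFieldI, (0.2) p.176] -/
theorem Seq_allSmall_of_top {k : ℕ} (s' : SeqOfRecord F ν M g K (k + 1)) (hΩ : s'.Ω (k + 1) = Set.univ) (hΛ : s'.Λ (k + 1) = Set.univ) :
    ∀ j, 1 ≤ j → j ≤ k + 1 → s'.Ω j = Set.univ ∧ s'.Λ j = Set.univ := fun j h1 hj => by
  have _ := hΩ
  have hΛj : s'.Λ j = Set.univ := Set.eq_univ_of_univ_subset (hΛ ▸ s'.chain.Λ_antitone h1 hj le_rfl)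
  exact ⟨Set.eq_univ_of_univ_subset (hΛj ▸ s'.chain.Λ_subset j h1 hj), hΛj⟩

/-- ★★ **THE BRANCH OPERATOR OF AN ALL-SMALL HISTORY IS MULTIPLICATION BY THE PRODUCT OF ITS SCALAR WEIGHTS, POINTWISE**: if `Ω_{j+1}(s) = Λ_{j+1}(s) = 𝕋` for `j < i`, then
`𝐓_i(s, S) Φ (ω) = (Π_{j<i} ζ_j(∅)(ω) · w_j(𝕋, ∅, S_{j+1})(ω)) · Φ(ω)` — (2.20)'s ordered product of (2.22)-generations. [cite: Balaban1988Convergent, (2.20)–(2.22) p.258, (3.24) p.270] -/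
theorem tkBranchOfRecord_of_allSmall {k : ℕ} (s : SeqOfRecord F ν M g K k) (S : ℕ → Set (Site (F.P K) 0)) (i : ℕ)
    (hall : ∀ j, j < i → s.Ω (j + 1) = Set.univ ∧ s.Λ (j + 1) = Set.univ) (Φ : MultiCfg (F.P K) (SU N) V → ℝ) (ω : MultiCfg (F.P K) (SU N) V) :
    tkBranchOfRecord F N V ν M g K W s S i Φ ω = (∏ j ∈ Finset.range i, W.ζ j ∅ ω * W.w j Set.univ ∅ (S (j + 1)) ω) * Φ ω := by
  induction i with
  | zero => rw [tkBranchOfRecord_zero, Finset.range_zero, Finset.prod_empty, one_mul]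
  | succ i ih =>
    rw [tkBranchOfRecord_succ, genOp_genDataOfRecord_of_top' V ν M g K W s S i (hall i (Nat.lt_succ_self i)).1 (hall i (Nat.lt_succ_self i)).2,
      ih (fun j hj => hall j (Nat.lt_succ_of_lt hj)), Finset.prod_range_succ]
    ring

/-- ★★ **`𝐓_k(s)` OF AN ALL-SMALL HISTORY, READ AT THE FIELD**: if `Ω_j = Λ_j = 𝕋` for `1 ≤ j ≤ k`, the `{S_j}`-index is the all-empty branch alone (`TkOfRecord_of_eq`) and
`𝐓_k(s)[W] Φ (V) = (Π_{j<k} ζ_j(∅)·w_j(𝕋, ∅, ∅))(base_k V) · Φ(∅-branch, 0, base-gauge_k V)`. [cite: Balaban1988Convergent, (2.18) p.257, (2.20)–(2.22) p.258] -/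
theorem TkOfRecord_of_allSmall {k : ℕ} (s : SeqOfRecord F ν M g K k) (hall : ∀ j, 1 ≤ j → j ≤ k → s.Ω j = Set.univ ∧ s.Λ j = Set.univ)
    (Φ : SFluct (F.P K) V → B15DeterminingSets.MSField (F.P K) (SU N) → ℝ) (Vk : GaugeField (F.P K) k (SU N)) :
    TkOfRecord F N V ν M g K W k s Φ Vk =
      (∏ j ∈ Finset.range k, W.ζ j ∅ (baseCfg k Vk) * W.w j Set.univ ∅ ∅ (baseCfg k Vk)) *
        Φ (fun _ => ∅, fun _ => 0) (fun j => ((baseCfg (V := V) k Vk) j).1) := by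
  rw [TkOfRecord_of_eq F N V ν M g K W k s (fun j h1 hj => by rw [(hall j h1 hj).1, (hall j h1 hj).2]) Φ Vk,
    tkBranchOfRecord_of_allSmall V ν M g K W s (fun _ => ∅) k (fun j hj => hall (j + 1) (Nat.succ_pos j) (Nat.succ_le_of_lt hj)) _ (baseCfg k Vk)]
  rfl

/-- ★★ **`𝐓_{k+1}(s′)` AT THE TOP CHILD**: for a history `s′` with `(Ω_{k+1}, Λ_{k+1})(s′) = (𝕋, 𝕋)`,
`𝐓_{k+1}(s′)[W] Φ (V′) = (Π_{j ≤ k} ζ_j(∅)·w_j(𝕋, ∅, ∅))(base_{k+1} V′) · Φ(∅-branch, 0, base-gauge_{k+1} V′)` — no integration at all. [cite: Balaban1988Convergent, (2.18) p.257, (2.20)–(2.22) p.258, (3.24) p.270] -/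
theorem TkOfRecord_succ_of_top {k : ℕ} (s' : SeqOfRecord F ν M g K (k + 1)) (hΩ : s'.Ω (k + 1) = Set.univ) (hΛ : s'.Λ (k + 1) = Set.univ)
    (Φ : SFluct (F.P K) V → B15DeterminingSets.MSField (F.P K) (SU N) → ℝ) (V' : GaugeField (F.P K) (k + 1) (SU N)) :
    TkOfRecord F N V ν M g K W (k + 1) s' Φ V' =
      (∏ j ∈ Finset.range (k + 1), W.ζ j ∅ (baseCfg (k + 1) V') * W.w j Set.univ ∅ ∅ (baseCfg (k + 1) V')) *
        Φ (fun _ => ∅, fun _ => 0) (fun j => ((baseCfg (V := V) (k + 1) V') j).1) :=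
  TkOfRecord_of_allSmall V ν M g K W s' (Seq_allSmall_of_top ν M g K s' hΩ hΛ) Φ V'

end Generation

/-! ## §2. The §2-form slot at the top child -/

section Sect2Slot

variable (V : Type) [NormedAddCommGroup V] [InnerProductSpace ℝ V] [FiniteDimensional ℝ V] [MeasurableSpace V] [BorelSpace V]
  {𝔸 : Type*} [NormedRing 𝔸] [NormedAlgebra ℂ 𝔸] [CompleteSpace 𝔸]
  {ν : Stage7Numerics} {M : ℕ} {g : ℕ → ℝ} (K : ℕ) (Sg : Sect2.Setting 𝔸 (SU N)) (Rz : Sect2.Residual (F.P K) 𝔸) (W : TkWeights F N V K)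

/-- ★★ **THE §2-FORM SLOT AT THE TOP CHILD** (11c's `sect2Slot = 𝐓_{k+1}(s′)[W] exp A_{k+1}(s′)`): for `(Ω_{k+1}, Λ_{k+1})(s′) = (𝕋, 𝕋)`,
`sect2Slot … s′ t E U (V′) = (Π_{j ≤ k} ζ_j(∅)·w_j(𝕋, ∅, ∅))(base_{k+1} V′) · exp A_{k+1}(s′; t, (∅-branch, 0), E)(U(base-gauge_{k+1} V′))` — the new action EVALUATED, nothing integrated.
[cite: Balaban1988Convergent, (2.18) p.257, (2.23) p.258, (2.22) p.258] -/
theorem sect2Slot_top_eq {k : ℕ} (s' : SeqOfRecord F ν M g K (k + 1)) (hΩ : s'.Ω (k + 1) = Set.univ) (hΛ : s'.Λ (k + 1) = Set.univ)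
    (t : Sect2.TermValues (F.P K) 𝔸 V M) (E : ℝ) (U : BgMap F N K) (V' : GaugeField (F.P K) (k + 1) (SU N)) :
    sect2Slot F N V K Sg Rz W s' t E U V' =
      (∏ j ∈ Finset.range (k + 1), W.ζ j ∅ (baseCfg (k + 1) V') * W.w j Set.univ ∅ ∅ (baseCfg (k + 1) V')) *
        sect2Operand F N V K Sg Rz s' t E U (fun _ => ∅, fun _ => 0) (fun j => ((baseCfg (V := V) (k + 1) V') j).1) :=
  TkOfRecord_succ_of_top V ν M g K W s' hΩ hΛ _ V'

/-- The same with 11c's operand opened: `… = prefactor(V′) · exp((A-data of record at (s′, t, (∅, 0), E)).action23 (k+1) (U(base-gauge_{k+1} V′)))`.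
[cite: Balaban1988Convergent, (2.23) p.258 (bookkeeping)] -/
theorem sect2Slot_top_eq_exp {k : ℕ} (s' : SeqOfRecord F ν M g K (k + 1)) (hΩ : s'.Ω (k + 1) = Set.univ) (hΛ : s'.Λ (k + 1) = Set.univ)
    (t : Sect2.TermValues (F.P K) 𝔸 V M) (E : ℝ) (U : BgMap F N K) (V' : GaugeField (F.P K) (k + 1) (SU N)) :
    sect2Slot F N V K Sg Rz W s' t E U V' =
      (∏ j ∈ Finset.range (k + 1), W.ζ j ∅ (baseCfg (k + 1) V') * W.w j Set.univ ∅ ∅ (baseCfg (k + 1) V')) *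
        Real.exp ((sect2ActionDataOfRecord F N V K Sg Rz s' t (fun _ => ∅, fun _ => 0) E).action23 (k + 1)
          (U (fun j => ((baseCfg (V := V) (k + 1) V') j).1))) :=
  sect2Slot_top_eq V K Sg Rz W s' hΩ hΛ t E U V'

end Sect2Slot

/-! ## §3. def-T's pre-𝐑 slot at the top child with n02-b's step weights of record; the (O3′)-shaped clause there as ONE explicit identity -/

section PreRSlot

variable (F N)

/-- A factor not depending on the fine field comes out of def-T's transport of record (the kernel transport is linear in the density; no integrability needed).
[cite: Balaban1988Convergent, (3.1) p.264 (bookkeeping)] -/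
theorem transportOfRecord_const_mul (K k : ℕ) (c : ℝ) (f : Density (F.P K) k (SU N)) (V' : GaugeField (F.P K) (k + 1) (SU N)) :
    transportOfRecord F N K k (fun U => c * f U) V' = c * transportOfRecord F N K k f V' := by
  show (_ : ℝ) * ∫ U, c * f U ∂_ = c * ((_ : ℝ) * ∫ U, f U ∂_)
  rw [integral_const_mul]
  ring

variable (ν : Stage7Numerics) (τ : TowerNumerics) (E : B12.RunParams → ℝ) (A₁ : ℝ) (ζ : ZetaOfRecord F N ν τ.M) (ppSel : PpSelOfRecord F ν τ.M)
  (p : B12.RunParams) (g : ℕ → ℝ) (k : ℕ)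

/-- ★★ **def-T's PRE-𝐑 SLOT AT THE TOP CHILD**: for `(Ω_{k+1}, Λ_{k+1})(s′) = (𝕋, 𝕋)` and def-T's slot family of record with n02-b's step weights `wOfRecord A₁ ζ`,
`slotT_{k+1}(s′)(V′) = (Π_{□′} χ_{□′}(V′)) · ∫dU δ(ŪV′⁻¹) [χ′_k(ALL cubes)(U,V′) · (Σ_S ζ_{k+1}(∅,∅,(∅,S))(U,V′)) · (χ_k(init s′)(U) · slot_k(init s′)(U))]` — the (3.2) front product is a
function of the NEW field and leaves the transport. [cite: Balaban1988Convergent, (3.1) p.264, (3.2)–(3.5) p.265, (3.24)–(3.25) p.270] -/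
theorem slotsTOfRecord_succ_top_eq (hD : 0 < sideD F ν τ.M p g k) (s' : SeqOfRecord F ν τ.M g p.K (k + 1)) (hΩ : s'.Ω (k + 1) = Set.univ)
    (hΛ : s'.Λ (k + 1) = Set.univ) (V' : GaugeField (F.P p.K) (k + 1) (SU N)) :
    slotsTOfRecord F N ν τ E (wOfRecord F N ν τ.M A₁ ζ) ppSel p g (k + 1) s' V' =
      (∏ c : Iχ F ν p g k, chiFactor F N ν p g k c V') *
        transportOfRecord F N p.K k (fun U =>
          chiPrime (sect3DataOfRecord F N ν τ.M p g k s'.init) (avOfRecord F N p.K) (2 * deltaOfRecord ν g k A₁) (Finset.univ : Finset (Iχ F ν p g k)) U V' *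
            (∑ S : Finset (Iχ F ν p g k), ζ p g k s'.init ∅ ∅ (∅, S) U V') *
            (chiSeqOfRecord F N ν τ.M g p.K k s'.init U * slotsOfRecord F N ν τ E (wOfRecord F N ν τ.M A₁ ζ) ppSel p g k s'.init U)) V' := by
  rw [slotsTOfRecord_succ_apply]
  have hfun : (fun U => wOfRecord F N ν τ.M A₁ ζ p g k s' U V' *
        (chiSeqOfRecord F N ν τ.M g p.K k s'.init U * slotsOfRecord F N ν τ E (wOfRecord F N ν τ.M A₁ ζ) ppSel p g k s'.init U)) =
      fun U => (∏ c : Iχ F ν p g k, chiFactor F N ν p g k c V') *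
        (chiPrime (sect3DataOfRecord F N ν τ.M p g k s'.init) (avOfRecord F N p.K) (2 * deltaOfRecord ν g k A₁) (Finset.univ : Finset (Iχ F ν p g k)) U V' *
            (∑ S : Finset (Iχ F ν p g k), ζ p g k s'.init ∅ ∅ (∅, S) U V') *
            (chiSeqOfRecord F N ν τ.M g p.K k s'.init U * slotsOfRecord F N ν τ E (wOfRecord F N ν τ.M A₁ ζ) ppSel p g k s'.init U)) := by
    funext U
    rw [wOfRecord_top_eq_prod F N ν τ.M A₁ p g k ζ hD s' hΩ hΛ U V']
    ring
  rw [hfun, transportOfRecord_const_mul]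

/-- ★★ **… AND ON THE `χ_{k+1}`-SUPPORT THE FRONT PRODUCT IS `1`**: where `χ_{k+1}(s′)(V′) ≠ 0`,
`slotT_{k+1}(s′)(V′) = ∫dU δ(ŪV′⁻¹) [χ′_k(ALL cubes)(U,V′) · (Σ_S ζ_{k+1}(∅,∅,(∅,S))(U,V′)) · χ_k(init s′)(U) · slot_k(init s′)(U)]`.
[cite: Balaban1988Convergent, (3.1) p.264, (3.2)–(3.3) p.265, (3.25) p.270] -/
theorem slotsTOfRecord_succ_top_eq_of_chiSeq_ne_zero (hD : 0 < sideD F ν τ.M p g k) (s' : SeqOfRecord F ν τ.M g p.K (k + 1)) (hΩ : s'.Ω (k + 1) = Set.univ)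
    (hΛ : s'.Λ (k + 1) = Set.univ) (V' : GaugeField (F.P p.K) (k + 1) (SU N)) (hχ : chiSeqOfRecord F N ν τ.M g p.K (k + 1) s' V' ≠ 0) :
    slotsTOfRecord F N ν τ E (wOfRecord F N ν τ.M A₁ ζ) ppSel p g (k + 1) s' V' =
      transportOfRecord F N p.K k (fun U =>
        chiPrime (sect3DataOfRecord F N ν τ.M p g k s'.init) (avOfRecord F N p.K) (2 * deltaOfRecord ν g k A₁) (Finset.univ : Finset (Iχ F ν p g k)) U V' *
          (∑ S : Finset (Iχ F ν p g k), ζ p g k s'.init ∅ ∅ (∅, S) U V') *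
          (chiSeqOfRecord F N ν τ.M g p.K k s'.init U * slotsOfRecord F N ν τ E (wOfRecord F N ν τ.M A₁ ζ) ppSel p g k s'.init U)) V' := by
  rw [slotsTOfRecord_succ_top_eq F N ν τ E A₁ ζ ppSel p g k hD s' hΩ hΛ V', prod_chiFactor_eq_one_of_chiSeq_top_ne_zero F N ν τ.M p g k s' hΩ V' hχ, one_mul]

variable {𝔸 : Type*} [NormedRing 𝔸] [NormedAlgebra ℂ 𝔸] [CompleteSpace 𝔸]

/-- ★★★ **THE (O3′)-SHAPED CLAUSE AT THE TOP CHILD IS ONE EXPLICIT IDENTITY IN THE NEW FIELD.**  For `(Ω_{k+1}, Λ_{k+1})(s′) = (𝕋, 𝕋)`, def-T's slot family with n02-b's weights,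
11a's weights `W` and 11c's §2-form slot with ANY term values ∕ constant ∕ background map:
«`slotT_{k+1}(s′) = 0 ∨ ∀ᵐ V′, χ_{k+1}(s′)(V′) ≠ 0 → slotT_{k+1}(s′)(V′) = sect2Slot … s′ t E′ U (V′)`»
`↔` «`slotT_{k+1}(s′) = 0 ∨ ∀ᵐ V′, χ_{k+1}(s′)(V′) ≠ 0 →`
  `∫dU δ(ŪV′⁻¹) [χ′_k(ALL)(U,V′) · Σ_S ζ_{k+1}(∅,∅,(∅,S))(U,V′) · χ_k(init s′) slot_k(init s′)(U)] (V′) = (Π_{j ≤ k} ζ_j(∅)·w_j(𝕋,∅,∅))(base_{k+1} V′) · exp A_{k+1}(s′; t, (∅,0), E′)(U(base V′))`» —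
[I] Thm 1's small-field step ([III] Thm 2 at the main term) as ONE identity between a one-step transport and an explicit function of `V′`; no fibre, no chart, no `Y`-sum, no kept
variable. [cite: Balaban1988Convergent, Thm 1 p.262, Thm 2 p.263, (3.1) p.264, (3.24)–(3.25) p.270, (2.18) p.257, (2.22)–(2.23) p.258; Balaban1987RG1, Thm 1 p.259] -/
theorem O3_top_iff (Sg : Sect2.Setting 𝔸 (SU N)) (Rz : Sect2.Residual (F.P p.K) 𝔸) (W : TkWeights F N (FluctV N) p.K)
    (hD : 0 < sideD F ν τ.M p g k) (s' : SeqOfRecord F ν τ.M g p.K (k + 1)) (hΩ : s'.Ω (k + 1) = Set.univ) (hΛ : s'.Λ (k + 1) = Set.univ)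
    (t : Sect2.TermValues (F.P p.K) 𝔸 (FluctV N) τ.M) (E' : ℝ) (U : BgMap F N p.K) :
    (slotsTOfRecord F N ν τ E (wOfRecord F N ν τ.M A₁ ζ) ppSel p g (k + 1) s' = 0 ∨
      ∀ᵐ V' ∂fieldMeasure (F.P p.K) (k + 1) (SU N), chiSeqOfRecord F N ν τ.M g p.K (k + 1) s' V' ≠ 0 →
        slotsTOfRecord F N ν τ E (wOfRecord F N ν τ.M A₁ ζ) ppSel p g (k + 1) s' V' = sect2Slot F N (FluctV N) p.K Sg Rz W s' t E' U V') ↔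
    (slotsTOfRecord F N ν τ E (wOfRecord F N ν τ.M A₁ ζ) ppSel p g (k + 1) s' = 0 ∨
      ∀ᵐ V' ∂fieldMeasure (F.P p.K) (k + 1) (SU N), chiSeqOfRecord F N ν τ.M g p.K (k + 1) s' V' ≠ 0 →
        transportOfRecord F N p.K k (fun U =>
            chiPrime (sect3DataOfRecord F N ν τ.M p g k s'.init) (avOfRecord F N p.K) (2 * deltaOfRecord ν g k A₁) (Finset.univ : Finset (Iχ F ν p g k)) U V' *
              (∑ S : Finset (Iχ F ν p g k), ζ p g k s'.init ∅ ∅ (∅, S) U V') *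
              (chiSeqOfRecord F N ν τ.M g p.K k s'.init U * slotsOfRecord F N ν τ E (wOfRecord F N ν τ.M A₁ ζ) ppSel p g k s'.init U)) V' =
          (∏ j ∈ Finset.range (k + 1), W.ζ j ∅ (baseCfg (k + 1) V') * W.w j Set.univ ∅ ∅ (baseCfg (k + 1) V')) *
            Real.exp ((sect2ActionDataOfRecord F N (FluctV N) p.K Sg Rz s' t (fun _ => ∅, fun _ => 0) E').action23 (k + 1)
              (U (fun j => ((baseCfg (V := FluctV N) (k + 1) V') j).1)))) := by
  refine or_congr_right (Filter.eventually_congr (Filter.Eventually.of_forall fun V' => ?_))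
  refine imp_congr_right fun hχ => ?_
  rw [slotsTOfRecord_succ_top_eq_of_chiSeq_ne_zero F N ν τ E A₁ ζ ppSel p g k hD s' hΩ hΛ V' hχ,
    sect2Slot_top_eq_exp (FluctV N) p.K Sg Rz W s' hΩ hΛ t E' U V']

end PreRSlot

end Summit.QuantumFields.YangMills.Theorems.BalabanUVNodesN11TopChildTStep

end
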